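import Mathlib.MeasureTheory.Integral.IntegrableOn
import Literature.NumberTheory.Transcendental.KZCalculus
import Literature.NumberTheory.Transcendental.KZDominatedFamilyRelations
import Literature.NumberTheory.Transcendental.KZLogCalculusProofs
import Literature.NumberTheory.Transcendental.KZRegCalculus
import Literature.NumberTheory.Transcendental.SemialgebraicMapsProofs

/-!
# `BetaCancellation` (stmt-KontsevichZagierPeriods-13633), line `divisor-slicing-transshipment` — stub `stub_fmcDescent`

**Finite measured correspondence descent.** Let `A`, `B` be integral representations of dimension
`d` and let finitely many *sheets* be given: `ℚ`-semialgebraic source pieces `U i ⊆ A.domain`,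
`ℚ`-semialgebraic injective maps `s i` on `U i` with derivatives `s' i` within `U i` and
`s i '' U i ⊆ B.domain`, weights `w i` on `U i` and densities `g i` on `s i '' U i`
(`ℚ`-semialgebraic, integrable) with the rule-(2) identity `w i a = g i (s i a) · |det (s' i a)|`
on `U i`. If the source marginal `Σᵢ 𝟙_{U i} w i` equals `A.integrand` a.e. on `A.domain` and the
target marginal `Σᵢ 𝟙_{s i '' U i} g i` equals `B.integrand` a.e. on `B.domain`, then `A ∼ B`
(`KZ.Equivalent A B`), using only rules (1a) domain additivity, (1b) integrand additivity and
(2) change of variables of the Kontsevich–Zagier calculus, plus null-set junk.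

Proof. Each sheet is ONE change-of-variables generator `[U i, w i] − [s i '' U i, g i]`
(`KZ.changeOfVariablesRel`). On the source side (`of_sub_sum_of_mem_relations`), the good set
`E = {a ∈ σ | f a = Σᵢ 𝟙_{U i} w i a}` is `ℚ`-semialgebraic (`isSemialgebraic_sep_eq`) with null
complement, so both `[σ, f]` and `[σ, Σᵢ 𝟙_{U i} w i]` are congruent to their restrictions to `E`
(`KZ.IntegralRep.of_sub_of_restrict_mem_relations`), which agree (`KZ.of_sub_of_mem_relations_of_eqOn`);
then `[σ, Σᵢ 𝟙_{U i} w i] ≡ Σᵢ [σ, 𝟙_{U i} w i]` by iterated integrand additivity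
(`KZ.of_sub_of_sub_sum_mem_relations`), and `[σ, 𝟙_{U i} w i] ≡ [U i, w i]` by one domain-additivity
move `σ = U i ∪ (σ ∖ U i)`, the second piece having zero integrand
(`of_sub_of_mem_relations_of_indicator`). The target side is the same statement for `B` and the
images. Summing, `[A] − [B] = ([A] − Σ [Pᵢ]) + Σ ([Pᵢ] − [Qᵢ]) − ([B] − Σ [Qᵢ])` is a relation.
No definitions; sorry-free; axioms ⊆ {propext, Classical.choice, Quot.sound}.

References: M. Kontsevich, D. Zagier, *Periods* (2001), §1.2 rules (1)–(2); J. Bochnak, M. Coste,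
M.-F. Roy, *Real Algebraic Geometry* (1998), Thm. 2.2.1, Prop. 2.2.6–2.2.7.
-/

noncomputable section

-- `Summit.KontsevichZagierPeriods.KontsevichZagierPeriods.…` is the tree's mandated layout (single-conjunct summit).
set_option linter.dupNamespace false

open MeasureTheory Set
open Literature.NumberTheory.Transcendental
open Literature.NumberTheory.Transcendental.KZ
open Literature.ModelTheory.ExponentialFields (IsSemialgebraic isSemialgebraic_univ)

namespace Summit.KontsevichZagierPeriods.KontsevichZagierPeriods.BetaCancellationDivisorSlicing

/-! ### One domain-additivity move: extension by zero -/

/-- **Extension by zero is a relation away from the piece.** If `P.domain ⊆ R.domain` and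
`R.integrand = 𝟙_{P.domain} P.integrand`, then `[R] − [P] ∈ relations`: domain additivity
`R.domain = P.domain ∪ (R.domain ∖ P.domain)` (the intersection is empty), the integrands agree on
`P.domain` (`Set.indicator_of_mem`), and the second piece has integrand `≡ 0` on its domain, hence
is a relation (`KZ.of_mem_relations_of_eqOn_zero`).
[cite: KontsevichZagier2001, §1.2 rule (1)] -/
theorem of_sub_of_mem_relations_of_indicator {d : ℕ} (R P : IntegralRep d)
    (hP : P.domain ⊆ R.domain) (hR : R.integrand = P.domain.indicator P.integrand) :
    of R - of P ∈ relations := by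
  have hdiff : IsSemialgebraic ℚ (R.domain \ P.domain) :=
    R.isSemialgebraic_domain.diff P.isSemialgebraic_domain
  have hsub : R.domain \ P.domain ⊆ R.domain := Set.sdiff_subset
  have hdom : R.domain = P.domain ∪ (R.restrict (R.domain \ P.domain) hdiff hsub).domain := by
    rw [IntegralRep.domain_restrict, Set.union_sdiff_cancel hP]
  have hnull : volume (P.domain ∩ (R.restrict (R.domain \ P.domain) hdiff hsub).domain) = 0 := by
    rw [IntegralRep.domain_restrict, Set.inter_sdiff_self]
    exact measure_empty
  have hadd : of R - of P - of (R.restrict (R.domain \ P.domain) hdiff hsub) ∈ domainAddRel :=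
    ⟨d, R, P, R.restrict (R.domain \ P.domain) hdiff hsub, hdom, hnull,
      fun a ha => by rw [hR, indicator_of_mem ha], fun _ _ => rfl, rfl⟩
  have hN : of (R.restrict (R.domain \ P.domain) hdiff hsub) ∈ relations :=
    of_mem_relations_of_eqOn_zero _ fun a ha => by
      show R.integrand a = 0
      rw [hR, indicator_of_notMem ha.2]
  have h := relations.add_mem (domainAddRel_subset_relations hadd) hN
  simpa using h

/-! ### Exact marginals descend to the pieces -/

/-- **An exact finite marginal splits into its pieces.** If `P i` (`i < m`) are representations
with `(P i).domain ⊆ A.domain` and `Σᵢ 𝟙_{(P i).domain} (P i).integrand = A.integrand` almost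
everywhere on `A.domain`, then `[A] − Σᵢ [P i] ∈ relations`: restrict `A` and
`A₁ = [A.domain, Σᵢ 𝟙 (P i).integrand]` to the co-null `ℚ`-semialgebraic good set where the two
integrands agree (`isSemialgebraic_sep_eq`, `KZ.IntegralRep.of_sub_of_restrict_mem_relations`,
`KZ.of_sub_of_mem_relations_of_eqOn`), split `A₁` by iterated integrand additivity
(`KZ.of_sub_of_sub_sum_mem_relations`), and pass from each extension by zero to the piece
(`of_sub_of_mem_relations_of_indicator`). [cite: KontsevichZagier2001, §1.2 rule (1)] -/
theorem of_sub_sum_of_mem_relations {d m : ℕ} (A : IntegralRep d) (P : Fin m → IntegralRep d)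
    (hP : ∀ i, (P i).domain ⊆ A.domain)
    (hae : (fun a => ∑ i, (P i).domain.indicator (P i).integrand a) =ᵐ[volume.restrict A.domain]
      A.integrand) :
    of A - ∑ i, of (P i) ∈ relations := by
  have hσ : IsSemialgebraic ℚ A.domain := A.isSemialgebraic_domain
  have hσm : MeasurableSet A.domain := IntegralRep.measurableSet_domain_holds A
  have hind : ∀ i, IsSemialgebraicFunOn ℚ A.domain ((P i).domain.indicator (P i).integrand) :=
    fun i => IsSemialgebraicFunOn.indicator hσ (P i).isSemialgebraic_domain
      ((P i).isSemialgebraicFunOn_integrand.mono inter_subset_right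
        (hσ.inter (P i).isSemialgebraic_domain))
  have hint : ∀ i, IntegrableOn ((P i).domain.indicator (P i).integrand) A.domain := fun i =>
    ((P i).integrableOn.integrable_indicator
      (IntegralRep.measurableSet_domain_holds (P i))).integrableOn
  -- the extensions by zero `R i = [σ, 𝟙_{σᵢ} fᵢ]`
  obtain ⟨R, hRd, hRi⟩ : ∃ R : Fin m → IntegralRep d, (∀ i, (R i).domain = A.domain) ∧
      ∀ i, (R i).integrand = (P i).domain.indicator (P i).integrand :=
    ⟨fun i => ⟨A.domain, (P i).domain.indicator (P i).integrand, hσ, hind i, hint i⟩,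
      fun _ => rfl, fun _ => rfl⟩
  -- their sum `A₁ = [σ, Σᵢ 𝟙_{σᵢ} fᵢ]`
  obtain ⟨A₁, hA₁d, hA₁i⟩ : ∃ A₁ : IntegralRep d, A₁.domain = A.domain ∧
      A₁.integrand = fun a => ∑ i, (P i).domain.indicator (P i).integrand a :=
    ⟨⟨A.domain, fun a => ∑ i, (P i).domain.indicator (P i).integrand a, hσ,
      isSemialgebraicFunOn_finset_sum _ hσ fun i _ => hind i,
      integrable_finsetSum _ fun i _ => hint i⟩, rfl, rfl⟩
  -- (1) `[A] ≡ [A₁]`: both restrict to the co-null good set `E`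
  set E : Set (Fin d → ℝ) := {a | a ∈ A.domain ∧ A.integrand a = A₁.integrand a} with hE_def
  have hA₁f : IsSemialgebraicFunOn ℚ A.domain A₁.integrand := hA₁d ▸ A₁.isSemialgebraicFunOn_integrand
  have hE : IsSemialgebraic ℚ E := isSemialgebraic_sep_eq A.isSemialgebraicFunOn_integrand hA₁f
  have hEσ : E ⊆ A.domain := fun a ha => ha.1
  have hEσ₁ : E ⊆ A₁.domain := fun a ha => by rw [hA₁d]; exact ha.1
  have hvol : volume (A.domain \ E) = 0 := by
    rw [measure_eq_zero_iff_ae_notMem]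
    have hae' : ∀ᵐ a ∂volume, a ∈ A.domain →
        (fun a => ∑ i, (P i).domain.indicator (P i).integrand a) a = A.integrand a :=
      (ae_restrict_iff' hσm).mp hae
    filter_upwards [hae'] with a ha hmem
    refine hmem.2 ⟨hmem.1, ?_⟩
    rw [hA₁i]
    exact (ha hmem.1).symm
  have hvol₁ : volume (A₁.domain \ E) = 0 := by rw [hA₁d]; exact hvol
  have h₁ : of A - of (A.restrict E hE hEσ) ∈ relations :=
    A.of_sub_of_restrict_mem_relations hE hEσ hvol
  have h₂ : of A₁ - of (A₁.restrict E hE hEσ₁) ∈ relations :=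
    A₁.of_sub_of_restrict_mem_relations hE hEσ₁ hvol₁
  have h₃ : of (A.restrict E hE hEσ) - of (A₁.restrict E hE hEσ₁) ∈ relations :=
    of_sub_of_mem_relations_of_eqOn rfl fun a ha => ha.2
  have hAA₁ : of A - of A₁ ∈ relations := by
    have heq : of A - of A₁ = (of A - of (A.restrict E hE hEσ)) +
        (of (A.restrict E hE hEσ) - of (A₁.restrict E hE hEσ₁)) -
        (of A₁ - of (A₁.restrict E hE hEσ₁)) := by abel
    rw [heq]
    exact relations.sub_mem (relations.add_mem h₁ h₃) h₂
  -- (2) `[A₁] ≡ Σᵢ [R i]` by iterated integrand additivity (with a zero representation)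
  obtain ⟨z, hzd, hzi⟩ := exists_zeroRep hσ
  have hz : of z ∈ relations := of_mem_relations_of_eqOn_zero z (by simp [hzi, EqOn])
  have hsum : of A₁ - of z - ∑ i, of (R i) ∈ relations :=
    of_sub_of_sub_sum_mem_relations m A₁ z R (hzd.trans hA₁d.symm)
      (fun i => (hRd i).trans hA₁d.symm) fun a _ => by simp [hA₁i, hzi, hRi]
  -- (3) `[R i] ≡ [P i]` by one domain-additivity move each
  have hRP : ∀ i, of (R i) - of (P i) ∈ relations := fun i =>
    of_sub_of_mem_relations_of_indicator (R i) (P i) (by rw [hRd]; exact hP i) (hRi i)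
  have hRP' : ∑ i, (of (R i) - of (P i)) ∈ relations := sum_mem fun i _ => hRP i
  rw [Finset.sum_sub_distrib] at hRP'
  -- (4) combine
  have heq : of A - ∑ i, of (P i) = (of A - of A₁) + (of A₁ - of z - ∑ i, of (R i)) + of z +
      (∑ i, of (R i) - ∑ i, of (P i)) := by abel
  rw [heq]
  exact relations.add_mem (relations.add_mem (relations.add_mem hAA₁ hsum) hz) hRP'

/-! ### The stub -/

/-- STUB `stub_fmcDescent` (finite measured correspondence descent). Finitely many
`ℚ`-semialgebraic sheets `s i : U i → B.domain` (`U i ⊆ A.domain`), weights `w i` on the source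
pieces and transported densities `g i` on the images with `w i = (g i ∘ s i) · |det (s' i)|`, whose
source marginal is `A.integrand` a.e. on `A.domain` and whose target marginal is `B.integrand`
a.e. on `B.domain`, give `A ∼ B`: each sheet is ONE change-of-variables generator
`[U i, w i] − [s i '' U i, g i]` (`KZ.changeOfVariablesRel`), and each exact marginal descends to
its pieces (`of_sub_sum_of_mem_relations`), so
`[A] − [B] = ([A] − Σ [Pᵢ]) + Σ ([Pᵢ] − [Qᵢ]) − ([B] − Σ [Qᵢ])` is a relation.
[cite: KontsevichZagier2001, §1.2 rule (2)] -/
theorem stub_fmcDescent : ∀ (d : ℕ) (A B : IntegralRep d) (m : ℕ) (U : Fin m → Set (Fin d → ℝ)) (s : Fin m → (Fin d → ℝ) → (Fin d → ℝ)) (s' : Fin m → (Fin d → ℝ) → ((Fin d → ℝ) →L[ℝ] (Fin d → ℝ))) (w g : Fin m → (Fin d → ℝ) → ℝ), (∀ i, IsSemialgebraic ℚ (U i) ∧ U i ⊆ A.domain) → (∀ i, IsSemialgebraicMapOn ℚ (U i) (s i) ∧ Set.InjOn (s i) (U i) ∧ (∀ a ∈ U i, HasFDerivWithinAt (s i) (s'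 i a) (U i) a) ∧ s i '' U i ⊆ B.domain) → (∀ i, IsSemialgebraicFunOn ℚ (U i) (w i) ∧ IntegrableOn (w i) (U i) ∧ IsSemialgebraicFunOn ℚ (s i '' U i) (g i) ∧ IntegrableOn (g i) (s i '' U i) ∧ ∀ a ∈ U i, w i a = g i (s i a) * |(s' i a).det|) → (fun a => ∑ i, (U i).indicator (w i) a) =ᵐ[volume.restrict A.domain] A.integrand → (fun b => ∑ i, (s i '' U i).indicator (g i) b) =ᵐ[volume.restrict B.domain] B.integrand → Equivalent A B := by
  intro d A B m U s s' w g hU hs hw hmA hmB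
  -- the images of the sheets are `ℚ`-semialgebraic (Tarski–Seidenberg)
  have hV : ∀ i, IsSemialgebraic ℚ (s i '' U i) := fun i =>
    IsSemialgebraicMapOn.isSemialgebraic_image_holds (hs i).1 subset_rfl (hU i).1
  -- source pieces `P i = [U i, w i]` and target pieces `Q i = [s i '' U i, g i]`
  obtain ⟨P, hPd, hPi⟩ : ∃ P : Fin m → IntegralRep d, (∀ i, (P i).domain = U i) ∧
      ∀ i, (P i).integrand = w i :=
    ⟨fun i => ⟨U i, w i, (hU i).1, (hw i).1, (hw i).2.1⟩, fun _ => rfl, fun _ => rfl⟩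
  obtain ⟨Q, hQd, hQi⟩ : ∃ Q : Fin m → IntegralRep d, (∀ i, (Q i).domain = s i '' U i) ∧
      ∀ i, (Q i).integrand = g i :=
    ⟨fun i => ⟨s i '' U i, g i, hV i, (hw i).2.2.1, (hw i).2.2.2.1⟩, fun _ => rfl, fun _ => rfl⟩
  -- rule (2): each sheet is one change-of-variables generator
  have hPQ : ∀ i, of (P i) - of (Q i) ∈ relations := fun i => by
    refine changeOfVariablesRel_subset_relations ⟨d, P i, Q i, s i, s' i, ?_, ?_, ?_, ?_, ?_, rfl⟩
    · rw [hPd]; exact (hs i).1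
    · rw [hPd]; exact (hs i).2.2.1
    · rw [hPd]; exact (hs i).2.1
    · rw [hPd, hQd]
    · intro a ha
      rw [hPd] at ha
      rw [hPi, hQi]
      exact (hw i).2.2.2.2 a ha
  have hPQ' : ∑ i, (of (P i) - of (Q i)) ∈ relations := sum_mem fun i _ => hPQ i
  rw [Finset.sum_sub_distrib] at hPQ'
  -- the two exact marginals descend to the pieces
  have hA : of A - ∑ i, of (P i) ∈ relations := by
    refine of_sub_sum_of_mem_relations A P (fun i => by rw [hPd]; exact (hU i).2) ?_
    simp only [hPd, hPi]
    exact hmA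
  have hB : of B - ∑ i, of (Q i) ∈ relations := by
    refine of_sub_sum_of_mem_relations B Q (fun i => by rw [hQd]; exact (hs i).2.2.2) ?_
    simp only [hQd, hQi]
    exact hmB
  -- combine
  have heq : of A - of B =
      (of A - ∑ i, of (P i)) + (∑ i, of (P i) - ∑ i, of (Q i)) - (of B - ∑ i, of (Q i)) := by
    abel
  show of A - of B ∈ relations
  rw [heq]
  exact relations.sub_mem (relations.add_mem hA hPQ') hB

end Summit.KontsevichZagierPeriods.KontsevichZagierPeriods.BetaCancellationDivisorSlicing

end
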